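import Literature.NumberTheory.EllipticCurves.PadicFiltrationIndexProofs
import Literature.NumberTheory.EllipticCurves.PadicPointsHomFiltrationProofs
import HarnessLib

/-!
# The `p`-adic logarithm lattice of `E(ℚ_p)`: `L([E : E⁽²⁾] · E(ℚ_p)) = ℤ_p · (#E(ℚ_p)_tors · p²)` exactly —
# the local index `log_ω(E(ℚ_p) ⊗ ℤ_p) = p^{τ + 1 − v_p(c_p #Ẽ_ns(𝔽_p))} ℤ_p` at a prime of ANY reduction,
# `= p^{τ − v_p(c_p)} ℤ_p` at an ADDITIVE prime (Kim–Nakamura Cor. 2.4 / C.-H. Kim AJM §3.2.3, log side)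

`Proofs` file (theorems only, no definitions, no named facts), topic `NumberTheory/EllipticCurves`; seat
`bsd-potss-kmc` (cell `bsd-potss`), generation 14, PART 21b.  Continues `PadicPointsFiltrationProofs` (the
limit logarithm `L = W.padicLimitLog`: an injective homomorphism `E⁽ⁿ⁾(ℚ_p) → ℚ_p` ONTO the ball `pⁿℤ_p`,
`n ≥ 2`) and `PadicFiltrationIndexProofs` (`[E(ℚ_p) : E⁽ⁿ⁾] = c_p · #Ẽ_ns(𝔽_p) · p^{n−1}`).

WHAT IS PROVED.  `W` a `ℤ_p`-integral equation of an elliptic curve over `ℚ_p`, `N = E⁽²⁾(ℚ_p)`,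
`m = [E(ℚ_p) : N]`, `Φ(P) = L(m • P)`.  `Φ` is additive with kernel `E(ℚ_p)_tors` (`ker_eq_torsion`), so
`E(ℚ_p)_tors` is FINITE and meets `N` trivially and `m = #E(ℚ_p)_tors · k`, `k = [Φ(E) : Φ(N)]`
(`index_formalFiltration_two_eq_card_torsion_mul_relIndex`); `Φ(N) = ℤ_p · (m p²)`
(`map_formalFiltration_two_eq_span`); `k • Φ(E) ⊆ Φ(N)` gives the UPPER BOUND `‖Φ(P)‖ ≤ ‖#E(ℚ_p)_tors · p²‖`
(`norm_padicLimitLog_index_nsmul_le`); the count of `ℤ_p`-balls `[ℤ_p c : ℤ_p p^e c] = p^e`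
(`relIndex_span_pow_mul`, via `PadicInt.toZModPow`) squeezes `Φ(N) ≤ Φ(E) ≤ ℤ_p · (#E(ℚ_p)_tors p²)`, outer
index `p^{v_p k} ≤ k`: hence `Φ(E(ℚ_p)) = ℤ_p · (#E(ℚ_p)_tors · p²)` EXACTLY and `k = p^{v_p k}`
(`range_eq_span_and_relIndex_eq`, `exists_padicLimitLog_index_nsmul_eq_iff`, `exists_norm_…_eq`,
`exists_card_torsion_mul_pow_eq_index`).  Exponent form: `‖L(m • P)‖ ≤ p^{−(τ+2)}` attained,
`τ = v_p #E(ℚ_p)_tors`; for a minimal `W`, `m = c_p · #Ẽ_ns(𝔽_p) · p`, so the normalised lattice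
`log_ω(E(ℚ_p)) = p^{τ+1−v_p(c_p #Ẽ_ns)} ℤ_p`; for a globally minimal `W/ℚ` ADDITIVE at `p` (`#Ẽ_ns = p`):
`[E : E⁽²⁾] = c_p p²` and `log_ω(E(ℚ_p) ⊗ ℤ_p) = p^{τ − v_p(c_p)} ℤ_p`
(`norm_padicLimitLog_tamagawa_nsmul_of_additive`) — the Tate dual of `exp*_ω H¹(ℚ_p,T_pE) = c_p p^{−τ}ℤ_p`,
the local index of Kato's descent at an additive prime (Kato Prop. 14.16 (2); this cell's
`Kato2004.MemberHullInputs.count`; Kim–Nakamura Cor. 2.4 and proof of Thm. 4.5).  Only the statement on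
POINTS is proved; `exp*` is not a tree object.  No hypothesis on `p` (also `p = 2`).

References: J. H. Silverman, *AEC* 2nd ed. (2009) IV.3.2, IV.6.4, VII.2.1–2.2, VII.3.1, VII.6.3
[SilvermanAEC2009]; C.-H. Kim, K. Nakamura, J. Number Theory 210 (2020) = arXiv:1808.07726, Thm. 2.1, Prop. 2.2,
Cor. 2.4 [KimNakamura2020]; C.-H. Kim, Amer. J. Math. 148 (2026) = arXiv:2203.12159, §3.2.3 [Kim2022StructureSelmer].
-/

noncomputable section

namespace WeierstrassCurve

open scoped Classical
open Literature.NumberTheory.EllipticCurves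

/-! ## §1 Balls in `ℚ_p` as `ℤ_p`-spans and their relative indices -/

section Balls

variable {p : ℕ} [Fact p.Prime]

/-- Membership in the `ℤ_p`-span of `c ≠ 0` is the norm condition `‖t‖ ≤ ‖c‖` (the closed ball of radius
`‖c‖` is `ℤ_p · c`). [cite: Koblitz1984, Ch. I §2 (the `p`-adic norm) and §3 (`ℤ_p`)] -/
theorem mem_span_padicInt_singleton_iff {c : ℚ_[p]} (hc : c ≠ 0) (t : ℚ_[p]) :
    t ∈ (Submodule.span ℤ_[p] ({c} : Set ℚ_[p])) ↔ ‖t‖ ≤ ‖c‖ := by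
  rw [Submodule.mem_span_singleton]
  constructor
  · rintro ⟨a, rfl⟩
    rw [Algebra.smul_def, norm_mul]
    exact mul_le_of_le_one_left (norm_nonneg _) (by simpa using a.norm_le_one)
  · intro ht
    have hq : ‖t / c‖ ≤ 1 := by
      rw [norm_div, div_le_one (norm_pos_iff.mpr hc)]; exact ht
    refine ⟨⟨t / c, hq⟩, ?_⟩
    rw [Algebra.smul_def]
    change t / c * c = t
    rw [div_mul_cancel₀ t hc]

/-- **The count of `ℤ_p`-balls:** for `c ≠ 0` the span `ℤ_p · (p^e c)` has relative index `p^e` in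
`ℤ_p · c` (`ℤ_p/p^eℤ_p ≅ ℤ/p^e`, `PadicInt.toZModPow`). [cite: Koblitz1984, Ch. I §3 (`ℤ_p/p^nℤ_p ≅ ℤ/p^nℤ`)] -/
theorem relIndex_span_pow_mul (e : ℕ) {c : ℚ_[p]} (hc : c ≠ 0) :
    (Submodule.span ℤ_[p] ({(p : ℚ_[p]) ^ e * c} : Set ℚ_[p])).toAddSubgroup.relIndex
      (Submodule.span ℤ_[p] ({c} : Set ℚ_[p])).toAddSubgroup = p ^ e := by
  -- `f : ℤ_p → ℚ_p`, `a ↦ a · c`, injective with range `ℤ_p · c`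
  let f : ℤ_[p] →+ ℚ_[p] :=
    { toFun := fun a ↦ (a : ℚ_[p]) * c
      map_zero' := by simp
      map_add' := fun a b ↦ by push_cast; ring }
  have hf : Function.Injective f := by
    intro a b hab
    have : (a : ℚ_[p]) * c = (b : ℚ_[p]) * c := hab
    exact Subtype.coe_injective (mul_right_cancel₀ hc this)
  have hrange : f.range = (Submodule.span ℤ_[p] ({c} : Set ℚ_[p])).toAddSubgroup := by
    ext t
    rw [AddMonoidHom.mem_range, Submodule.mem_toAddSubgroup, Submodule.mem_span_singleton]
    constructor
    · rintro ⟨a, rfl⟩; exact ⟨a, by rw [Algebra.smul_def]; rfl⟩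
    · rintro ⟨a, rfl⟩; exact ⟨a, by rw [Algebra.smul_def]; rfl⟩
  -- the ideal `p^e ℤ_p` maps onto `ℤ_p · (p^e c)`
  let I : Ideal ℤ_[p] := Ideal.span {(p : ℤ_[p]) ^ e}
  have hmap : I.toAddSubgroup.map f =
      (Submodule.span ℤ_[p] ({(p : ℚ_[p]) ^ e * c} : Set ℚ_[p])).toAddSubgroup := by
    ext t
    rw [AddSubgroup.mem_map, Submodule.mem_toAddSubgroup, Submodule.mem_span_singleton]
    constructor
    · rintro ⟨a, ha, rfl⟩
      rw [Submodule.mem_toAddSubgroup, Ideal.mem_span_singleton] at ha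
      obtain ⟨b, rfl⟩ := ha
      refine ⟨b, ?_⟩
      rw [Algebra.smul_def]
      change (b : ℚ_[p]) * ((p : ℚ_[p]) ^ e * c) = (((p : ℤ_[p]) ^ e * b : ℤ_[p]) : ℚ_[p]) * c
      push_cast; ring
    · rintro ⟨b, rfl⟩
      refine ⟨(p : ℤ_[p]) ^ e * b, ?_, ?_⟩
      · rw [Submodule.mem_toAddSubgroup, Ideal.mem_span_singleton]; exact Dvd.intro b rfl
      · rw [Algebra.smul_def]
        change (((p : ℤ_[p]) ^ e * b : ℤ_[p]) : ℚ_[p]) * c = (b : ℚ_[p]) * ((p : ℚ_[p]) ^ e * c)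
        push_cast; ring
  -- relative index is transported along the injection `f`
  rw [← hmap, ← hrange, AddMonoidHom.range_eq_map, AddSubgroup.relIndex_map_map_of_injective _ _ hf,
    AddSubgroup.relIndex_top_right]
  -- `[ℤ_p : p^e ℤ_p] = #(ℤ/p^e)`
  have hker : (PadicInt.toZModPow e : ℤ_[p] →+* ZMod (p ^ e)).toAddMonoidHom.ker = I.toAddSubgroup := by
    ext a
    rw [AddMonoidHom.mem_ker, RingHom.toAddMonoidHom_eq_coe, AddMonoidHom.coe_coe,
      Submodule.mem_toAddSubgroup, ← RingHom.mem_ker, PadicInt.ker_toZModPow]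
  rw [← hker, AddSubgroup.index_ker, AddMonoidHom.range_eq_top_of_surjective _
    (ZMod.ringHom_surjective (PadicInt.toZModPow e)), AddSubgroup.card_top, Nat.card_eq_fintype_card,
    ZMod.card]

end Balls

/-! ## §2 The homomorphism `P ↦ L([E : E⁽²⁾] • P)`, its kernel and its image -/

section LogLattice

variable {p : ℕ} [Fact p.Prime] (W : WeierstrassCurve ℚ_[p]) [hW : W.IsIntegral ℤ_[p]]
  [W.IsElliptic]

/-- `[E(ℚ_p) : E⁽²⁾] • P ∈ E⁽²⁾` for every `P`. [cite: SilvermanAEC2009, VII.6.3] -/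
theorem index_nsmul_mem_formalFiltration_two (P : W.toAffine.Point) :
    (W.formalFiltration 2).index • P ∈ W.formalFiltration 2 :=
  (W.formalFiltration 2).nsmul_index_mem P

/-- The index `[E(ℚ_p) : E⁽²⁾]` is non-zero. [cite: SilvermanAEC2009, VII.6.3] -/
theorem index_formalFiltration_two_ne_zero : (W.formalFiltration 2).index ≠ 0 := by
  haveI := W.finiteIndex_formalFiltration 2
  exact AddSubgroup.FiniteIndex.index_ne_zero

/-- `L(m • (P + Q)) = L(m • P) + L(m • Q)` for `m = [E : E⁽²⁾]`. [cite: SilvermanAEC2009, VII.6.3] -/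
theorem padicLimitLog_index_nsmul_add (P Q : W.toAffine.Point) :
    W.padicLimitLog ((W.formalFiltration 2).index • (P + Q)) =
      W.padicLimitLog ((W.formalFiltration 2).index • P) +
        W.padicLimitLog ((W.formalFiltration 2).index • Q) := by
  rw [nsmul_add]
  exact W.padicLimitLog_add_of_mem le_rfl (W.index_nsmul_mem_formalFiltration_two P)
    (W.index_nsmul_mem_formalFiltration_two Q)

/-- A torsion point of `E⁽²⁾` is `O`: `L` is a homomorphism on `E⁽²⁾` injective into the torsion-free
group `ℚ_p`. [cite: SilvermanAEC2009, IV.6.4 and VII.6.3] -/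
theorem eq_zero_of_mem_formalFiltration_two_of_isOfFinAddOrder {P : W.toAffine.Point}
    (hP : P ∈ W.formalFiltration 2) (hfin : IsOfFinAddOrder P) : P = 0 := by
  obtain ⟨j, hj, hjP⟩ := (isOfFinAddOrder_iff_nsmul_eq_zero).mp hfin
  have h := W.padicLimitLog_nsmul_of_mem le_rfl hP j
  rw [hjP, W.padicLimitLog_zero] at h
  have hL : W.padicLimitLog P = 0 := by
    rcases mul_eq_zero.mp h.symm with h0 | h0
    · exact absurd (by exact_mod_cast h0 : j = 0) hj.ne'
    · exact h0
  exact W.eq_zero_of_padicLimitLog_eq_zero le_rfl hP hL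

/-- **`E⁽²⁾(ℚ_p) ∩ E(ℚ_p)_tors = 0`.** [cite: SilvermanAEC2009, VII.3.1 and VII.6.3] -/
theorem formalFiltration_two_inf_torsion_eq_bot :
    W.formalFiltration 2 ⊓ AddCommGroup.torsion W.toAffine.Point = ⊥ := by
  rw [eq_bot_iff]
  rintro P ⟨hP, hT⟩
  exact W.eq_zero_of_mem_formalFiltration_two_of_isOfFinAddOrder hP hT

/-- `L(m • P) = 0` iff `P` is torsion (`m = [E : E⁽²⁾]`). [cite: SilvermanAEC2009, VII.6.3] -/
theorem padicLimitLog_index_nsmul_eq_zero_iff (P : W.toAffine.Point) :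
    W.padicLimitLog ((W.formalFiltration 2).index • P) = 0 ↔ IsOfFinAddOrder P := by
  constructor
  · intro h
    have h0 := W.eq_zero_of_padicLimitLog_eq_zero le_rfl (W.index_nsmul_mem_formalFiltration_two P) h
    exact isOfFinAddOrder_iff_nsmul_eq_zero.mpr
      ⟨_, Nat.pos_of_ne_zero W.index_formalFiltration_two_ne_zero, h0⟩
  · intro hfin
    obtain ⟨j, hj, hjP⟩ := (isOfFinAddOrder_iff_nsmul_eq_zero).mp hfin
    have h := W.padicLimitLog_nsmul_of_mem le_rfl (W.index_nsmul_mem_formalFiltration_two P) j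
    rw [smul_comm, hjP, smul_zero, W.padicLimitLog_zero] at h
    rcases mul_eq_zero.mp h.symm with h0 | h0
    · exact absurd (by exact_mod_cast h0 : j = 0) hj.ne'
    · exact h0

/-- The image of `L` on `E⁽²⁾` is the ball `p²ℤ_p`: `‖L(Q)‖ ≤ p⁻²` and every such value is attained.
[cite: SilvermanAEC2009, IV.6.4 (b) and VII.6.3] -/
theorem exists_mem_formalFiltration_two_padicLimitLog_eq_iff (t : ℚ_[p]) :
    (∃ Q ∈ W.formalFiltration 2, W.padicLimitLog Q = t) ↔ ‖t‖ ≤ ((p : ℝ)⁻¹) ^ 2 := by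
  constructor
  · rintro ⟨Q, hQ, rfl⟩
    rw [W.norm_padicLimitLog_of_mem le_rfl hQ]
    exact hQ.2
  · exact fun ht ↦ W.exists_mem_padicLimitLog_eq le_rfl ht

/-- `‖(p : ℚ_p)²‖ = p⁻²`. [cite: Koblitz1984, Ch. I §2 (`|p|_p = 1/p`)] -/
theorem norm_natCast_prime_sq : ‖((p : ℚ_[p]) ^ 2)‖ = ((p : ℝ)⁻¹) ^ 2 := by
  rw [norm_pow, Padic.norm_p, inv_pow]

end LogLattice

/-! ## §3 The log lattice: kernel = torsion, `[E : E⁽²⁾] = #E(ℚ_p)_tors · [Φ(E) : Φ(E⁽²⁾)]`, and the index -/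

section Main

variable {p : ℕ} [Fact p.Prime] (W : WeierstrassCurve ℚ_[p]) [hW : W.IsIntegral ℤ_[p]]
  [W.IsElliptic]

/-- The homomorphism `Φ : P ↦ L([E : E⁽²⁾] • P)`, `E(ℚ_p) → ℚ_p` (as a bundled additive map).
[cite: SilvermanAEC2009, VII.6.3] -/
theorem exists_addMonoidHom_padicLimitLog_index_nsmul :
    ∃ Φ : W.toAffine.Point →+ ℚ_[p], ∀ P, Φ P = W.padicLimitLog ((W.formalFiltration 2).index • P) :=
  ⟨{ toFun := fun P ↦ W.padicLimitLog ((W.formalFiltration 2).index • P)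
     map_zero' := by rw [nsmul_zero, W.padicLimitLog_zero]
     map_add' := W.padicLimitLog_index_nsmul_add }, fun _ ↦ rfl⟩

/-- The kernel of `Φ` is the torsion subgroup. [cite: SilvermanAEC2009, VII.6.3] -/
theorem ker_eq_torsion {Φ : W.toAffine.Point →+ ℚ_[p]}
    (hΦ : ∀ P, Φ P = W.padicLimitLog ((W.formalFiltration 2).index • P)) :
    Φ.ker = AddCommGroup.torsion W.toAffine.Point := by
  ext P
  rw [AddMonoidHom.mem_ker, hΦ, AddCommGroup.mem_torsion, W.padicLimitLog_index_nsmul_eq_zero_iff]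

/-- **`#E(ℚ_p)_tors` divides `[E(ℚ_p) : E⁽²⁾]`; in particular the torsion of `E(ℚ_p)` is finite.**
(`E⁽²⁾ ∩ E(ℚ_p)_tors = 0` and `E⁽²⁾` is normal of finite index.) [cite: SilvermanAEC2009, VII.3.1 and VII.6.3] -/
theorem card_torsion_dvd_index_formalFiltration_two :
    Nat.card (AddCommGroup.torsion W.toAffine.Point) ∣ (W.formalFiltration 2).index := by
  have h := (W.formalFiltration 2).relIndex_dvd_index_of_normal
    (K := AddCommGroup.torsion W.toAffine.Point)
  rwa [← AddSubgroup.inf_relIndex_right, W.formalFiltration_two_inf_torsion_eq_bot,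
    AddSubgroup.relIndex_bot_left] at h

/-- **`E(ℚ_p)_tors` is finite** (for a `p`-integral equation of an elliptic curve over `ℚ_p`), in the
form `#E(ℚ_p)_tors ≠ 0` (`Nat.card`; use `Nat.finite_of_card_ne_zero`).
[cite: SilvermanAEC2009, VII.3.1 and VII.6.3] -/
theorem natCard_torsion_padicPoint_ne_zero : Nat.card (AddCommGroup.torsion W.toAffine.Point) ≠ 0 :=
  fun h ↦ W.index_formalFiltration_two_ne_zero
    (Nat.eq_zero_of_zero_dvd (h ▸ W.card_torsion_dvd_index_formalFiltration_two))

/-- **The count `[E(ℚ_p) : E⁽²⁾] = #E(ℚ_p)_tors · [Φ(E(ℚ_p)) : Φ(E⁽²⁾)]`:** the torsion subgroup meets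
`E⁽²⁾` trivially and is the kernel of `Φ`. [cite: SilvermanAEC2009, VII.6.3] -/
theorem index_formalFiltration_two_eq_card_torsion_mul_relIndex {Φ : W.toAffine.Point →+ ℚ_[p]}
    (hΦ : ∀ P, Φ P = W.padicLimitLog ((W.formalFiltration 2).index • P)) :
    (W.formalFiltration 2).index =
      Nat.card (AddCommGroup.torsion W.toAffine.Point) *
        ((W.formalFiltration 2).map Φ).relIndex Φ.range := by
  set N := W.formalFiltration 2
  set T := AddCommGroup.torsion W.toAffine.Point
  have h1 : N.relIndex (T ⊔ N) * (T ⊔ N).index = N.index := AddSubgroup.relIndex_mul_index le_sup_right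
  have h2 : N.relIndex (T ⊔ N) = Nat.card T := by
    rw [AddSubgroup.relIndex_sup_right, ← AddSubgroup.inf_relIndex_right,
      W.formalFiltration_two_inf_torsion_eq_bot, AddSubgroup.relIndex_bot_left]
  have h3 : (T ⊔ N).index = (N.map Φ).relIndex Φ.range := by
    rw [← AddSubgroup.index_comap, AddSubgroup.comap_map_eq, W.ker_eq_torsion hΦ, sup_comm]
  rw [← h1, h2, h3]

/-- **The image of `E⁽²⁾` under `Φ` is the ball `ℤ_p · ([E : E⁽²⁾] p²)`** (`Φ(Q) = m · L(Q)` on `E⁽²⁾` and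
`L(E⁽²⁾) = p²ℤ_p`). [cite: SilvermanAEC2009, IV.6.4 (b) and VII.6.3] -/
theorem map_formalFiltration_two_eq_span {Φ : W.toAffine.Point →+ ℚ_[p]}
    (hΦ : ∀ P, Φ P = W.padicLimitLog ((W.formalFiltration 2).index • P)) :
    (W.formalFiltration 2).map Φ =
      (Submodule.span ℤ_[p]
        ({((W.formalFiltration 2).index : ℚ_[p]) * (p : ℚ_[p]) ^ 2} : Set ℚ_[p])).toAddSubgroup := by
  have hm0 : ((W.formalFiltration 2).index : ℚ_[p]) ≠ 0 :=
    Nat.cast_ne_zero.mpr W.index_formalFiltration_two_ne_zero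
  have hp0 : (p : ℚ_[p]) ^ 2 ≠ 0 := pow_ne_zero _ (Nat.cast_ne_zero.mpr (Fact.out : p.Prime).ne_zero)
  have hc : ((W.formalFiltration 2).index : ℚ_[p]) * (p : ℚ_[p]) ^ 2 ≠ 0 := mul_ne_zero hm0 hp0
  ext t
  rw [AddSubgroup.mem_map, Submodule.mem_toAddSubgroup, mem_span_padicInt_singleton_iff hc, norm_mul,
    norm_natCast_prime_sq (p := p)]
  constructor
  · rintro ⟨Q, hQ, rfl⟩
    rw [hΦ, W.padicLimitLog_nsmul_of_mem le_rfl hQ, norm_mul]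
    exact mul_le_mul_of_nonneg_left ((W.exists_mem_formalFiltration_two_padicLimitLog_eq_iff _).mp
      ⟨Q, hQ, rfl⟩) (norm_nonneg _)
  · intro ht
    have ht' : ‖t / ((W.formalFiltration 2).index : ℚ_[p])‖ ≤ ((p : ℝ)⁻¹) ^ 2 := by
      rw [norm_div, div_le_iff₀ (norm_pos_iff.mpr hm0), mul_comm]; exact ht
    obtain ⟨Q, hQ, hLQ⟩ := (W.exists_mem_formalFiltration_two_padicLimitLog_eq_iff _).mpr ht'
    refine ⟨Q, hQ, ?_⟩
    rw [hΦ, W.padicLimitLog_nsmul_of_mem le_rfl hQ, hLQ, mul_div_cancel₀ t hm0]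

/-- **UPPER BOUND: `‖L([E : E⁽²⁾] • P)‖ ≤ ‖#E(ℚ_p)_tors‖_p · p⁻²` for every `P ∈ E(ℚ_p)`** — i.e.
`log_ω(E(ℚ_p) ⊗ ℤ_p) ⊆ p^{τ+1}/(c_p #Ẽ_ns(𝔽_p)) · ℤ_p` for a minimal equation (`p^τ ∥ #E(ℚ_p)_tors`).
[cite: KimNakamura2020, Cor. 2.4 and proof of Thm. 4.5] [cite: Kim2022StructureSelmer, §3.2.3 display before Thm. 3.7]
[cite: SilvermanAEC2009, VII.6.3] -/
theorem norm_padicLimitLog_index_nsmul_le (P : W.toAffine.Point) :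
    ‖W.padicLimitLog ((W.formalFiltration 2).index • P)‖ ≤
      ‖((Nat.card (AddCommGroup.torsion W.toAffine.Point) : ℚ_[p]) * (p : ℚ_[p]) ^ 2)‖ := by
  obtain ⟨Φ, hΦ⟩ := W.exists_addMonoidHom_padicLimitLog_index_nsmul
  set N := W.formalFiltration 2
  set T := AddCommGroup.torsion W.toAffine.Point
  set k := (N.map Φ).relIndex Φ.range with hk
  have hcount := W.index_formalFiltration_two_eq_card_torsion_mul_relIndex hΦ
  have hm0 := W.index_formalFiltration_two_ne_zero
  have hk0 : k ≠ 0 := fun h ↦ hm0 (by rw [hcount, ← hk, h, mul_zero])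
  -- `k • Φ(P) ∈ Φ(E⁽²⁾) = ball of radius ‖m p²‖`
  have hmem : k • Φ P ∈ N.map Φ := (N.map Φ).nsmul_relIndex_mem ⟨P, rfl⟩
  rw [W.map_formalFiltration_two_eq_span hΦ, Submodule.mem_toAddSubgroup,
    mem_span_padicInt_singleton_iff (mul_ne_zero (Nat.cast_ne_zero.mpr hm0)
      (pow_ne_zero _ (Nat.cast_ne_zero.mpr (Fact.out : p.Prime).ne_zero)))] at hmem
  rw [← hΦ]
  -- divide by `‖k‖`: `‖m‖ = ‖#T‖ ‖k‖`
  have hkQ : ((k : ℚ_[p])) ≠ 0 := Nat.cast_ne_zero.mpr hk0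
  have hkpos : 0 < ‖(k : ℚ_[p])‖ := norm_pos_iff.mpr hkQ
  rw [nsmul_eq_mul, norm_mul] at hmem
  have hmcast : ((N.index : ℕ) : ℚ_[p]) = (Nat.card T : ℚ_[p]) * (k : ℚ_[p]) := by
    rw [hcount]; push_cast; rfl
  rw [hmcast, norm_mul, norm_mul, mul_comm ‖(Nat.card T : ℚ_[p])‖ ‖(k : ℚ_[p])‖, mul_assoc] at hmem
  rw [norm_mul]
  exact le_of_mul_le_mul_left hmem hkpos

/-- **THE LOG LATTICE, EXACTLY: `Φ(E(ℚ_p)) = ℤ_p · (#E(ℚ_p)_tors · p²)`** — the range of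
`P ↦ L([E : E⁽²⁾] • P)` is the ball of radius `‖#E(ℚ_p)_tors‖_p p⁻²`; and `[Φ(E) : Φ(E⁽²⁾)]` is the exact
power of `p` dividing it.  Squeeze: `Φ(E⁽²⁾) = ℤ_p·(m p²) ≤ Φ(E) ≤ ℤ_p·(#T p²)` with `m = #T·k`, the outer
relative index being `p^{v_p k} ≤ k = [Φ(E) : Φ(E⁽²⁾)]`. [cite: KimNakamura2020, Cor. 2.4]
[cite: Kim2022StructureSelmer, §3.2.3] [cite: SilvermanAEC2009, VII.6.3] -/
theorem range_eq_span_and_relIndex_eq {Φ : W.toAffine.Point →+ ℚ_[p]}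
    (hΦ : ∀ P, Φ P = W.padicLimitLog ((W.formalFiltration 2).index • P)) :
    Φ.range = (Submodule.span ℤ_[p]
        ({((Nat.card (AddCommGroup.torsion W.toAffine.Point) : ℚ_[p])) * (p : ℚ_[p]) ^ 2} :
          Set ℚ_[p])).toAddSubgroup ∧
      ((W.formalFiltration 2).map Φ).relIndex Φ.range =
        p ^ padicValNat p (((W.formalFiltration 2).map Φ).relIndex Φ.range) := by
  set N := W.formalFiltration 2
  set T := AddCommGroup.torsion W.toAffine.Point
  set k := (N.map Φ).relIndex Φ.range with hk
  set c : ℚ_[p] := (Nat.card T : ℚ_[p]) * (p : ℚ_[p]) ^ 2 with hc_def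
  set B := (Submodule.span ℤ_[p] ({c} : Set ℚ_[p])).toAddSubgroup with hB
  have hcount := W.index_formalFiltration_two_eq_card_torsion_mul_relIndex hΦ
  have hm0 := W.index_formalFiltration_two_ne_zero
  have hk0 : k ≠ 0 := fun h ↦ hm0 (by rw [hcount, ← hk, h, mul_zero])
  have hT0 : Nat.card T ≠ 0 := W.natCard_torsion_padicPoint_ne_zero
  have hpQ : (p : ℚ_[p]) ≠ 0 := Nat.cast_ne_zero.mpr (Fact.out : p.Prime).ne_zero
  have hc0 : c ≠ 0 := mul_ne_zero (Nat.cast_ne_zero.mpr hT0) (pow_ne_zero _ hpQ)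
  -- (1) `Φ(E) ≤ B` (upper bound)
  have hle : Φ.range ≤ B := by
    rintro t ⟨P, rfl⟩
    rw [hB, Submodule.mem_toAddSubgroup, mem_span_padicInt_singleton_iff hc0, hΦ]
    exact W.norm_padicLimitLog_index_nsmul_le P
  -- (2) `Φ(N) = ℤ_p · (p^e c)` with `e = v_p k`: `m = #T k`, `k = p^e u`, `‖u‖ = 1`
  set e := padicValNat p k with he
  have hNle : N.map Φ ≤ Φ.range := AddSubgroup.map_le_range Φ N
  have hmapN : N.map Φ = (Submodule.span ℤ_[p] ({(p : ℚ_[p]) ^ e * c} : Set ℚ_[p])).toAddSubgroup := by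
    rw [W.map_formalFiltration_two_eq_span hΦ]
    -- two balls of the same radius
    have hmc : ((N.index : ℕ) : ℚ_[p]) * (p : ℚ_[p]) ^ 2 = (k : ℚ_[p]) * c := by
      rw [hcount]; push_cast; ring
    have hnormk : ‖(k : ℚ_[p])‖ = ‖(p : ℚ_[p]) ^ e‖ := by
      rw [Padic.norm_eq_zpow_neg_valuation (Nat.cast_ne_zero.mpr hk0), Padic.valuation_natCast, ← he,
        zpow_neg, zpow_natCast, norm_pow, Padic.norm_p, inv_pow]
    have hrad : ‖(((W.formalFiltration 2).index : ℕ) : ℚ_[p]) * (p : ℚ_[p]) ^ 2‖ =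
        ‖(p : ℚ_[p]) ^ e * c‖ := by
      rw [hmc, hc_def]; simp only [norm_mul, hnormk]
    ext t
    rw [Submodule.mem_toAddSubgroup, Submodule.mem_toAddSubgroup,
      mem_span_padicInt_singleton_iff (mul_ne_zero (Nat.cast_ne_zero.mpr hm0) (pow_ne_zero _ hpQ)),
      mem_span_padicInt_singleton_iff (mul_ne_zero (pow_ne_zero _ hpQ) hc0), hrad]
  -- (3) the squeeze on relative indices
  have hrel : (N.map Φ).relIndex B = p ^ e := by rw [hmapN, hB]; exact relIndex_span_pow_mul e hc0
  have hmul : (N.map Φ).relIndex Φ.range * Φ.range.relIndex B = p ^ e := by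
    rw [AddSubgroup.relIndex_mul_relIndex _ _ _ hNle hle, hrel]
  have hdvd : p ^ e ∣ k := pow_padicValNat_dvd
  have hpe0 : p ^ e ≠ 0 := pow_ne_zero _ (Fact.out : p.Prime).ne_zero
  have hx0 : Φ.range.relIndex B ≠ 0 := fun h ↦ hpe0 (by rw [← hmul, h, mul_zero])
  have hkle : k ≤ p ^ e := by
    calc k = k * 1 := (mul_one k).symm
      _ ≤ k * Φ.range.relIndex B := Nat.mul_le_mul_left k (Nat.one_le_iff_ne_zero.mpr hx0)
      _ = p ^ e := hmul
  have hkeq : k = p ^ e := le_antisymm hkle (Nat.le_of_dvd (Nat.pos_of_ne_zero hk0) hdvd)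
  have hx1 : Φ.range.relIndex B = 1 := by
    rw [← hk, hkeq] at hmul
    exact (mul_eq_left₀ hpe0).mp hmul
  refine ⟨le_antisymm hle (AddSubgroup.relIndex_eq_one.mp hx1), ?_⟩
  exact hkeq

end Main

end WeierstrassCurve

end
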